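import Literature.NumberTheory.EllipticCurves.ZpExtensionEisensteinSelmerStructure
import HarnessLib

/-!
# Cofinal sub-towers: the saturated level conditions of a tower and of its sub-tower of `m`-th levels agree
# (theorems only; no definition, no named fact, no instance, no `sorry`)

`Proofs` file in the currency of the tree's abstract towers `Literature.NumberTheory.EllipticCurves.Tower.*`
(`compatibleFamilies`, `saturatedFamilies`, `levelCondition`; file `ZpExtensionEisensteinSelmerStructure`).

Howard 2004 reads the compact `T_𝔮` through ANY cofinal system of finite quotients: `H¹(K_v, T_𝔮) =
lim_k H¹(K_v, T_𝔮/p^k) = lim_i H¹(K_v, T_𝔮/π^i)` (§1.6, arXiv:1202.6340 p. 12 L29–55: «`H¹_F(K,T) = lim H¹_F(K,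
T/𝔪^k T)`»; Serre, *Galois Cohomology* I §2.2).  In the tree the Selmer structure `F_𝔮` is DEFINED on the
`p`-adic tower (`ZpExtension.eisensteinSelmerStructure`: `Tower.levelCondition` of the local towers
`eisensteinLocalReduce`), while Hypothesis H.3 («cartesian on `Quot(T_k)`», all ideals `(π^i)` of the level ring)
is discharged on the `π`-adic refinement (`TowerSaturatedCartesianScalarProofs`, `TowerLocalH1LiftExactProofs`).
This file is the bridge COFINAL SUB-TOWER ↔ TOWER, abstractly and cast-free:

a FINE tower `(H' i)_i` presented by a two-index family of additive maps `g a b : H' a → H' b` (the reductions,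
meaningful for `b ≤ a`; `g a a = id`, `g b c ∘ g a b = g a c` for `c ≤ b ≤ a`), its one-step tower
`red' i := g (i+1) i`, a number `m ≥ 1`, and the SUB-TOWER of `m`-th levels `H'' j := H' (m*j)` with reductions
`red'' j := g (m*j+m) (m*j)` (this typechecks: `m*(j+1)` is `m*j+m` by `rfl`); cores `C' i` mapped into each
other by the `g a b` («the cores form a compatible family», true for `F_𝔮`: ordinary / unramified cores).

* §1 `Tower.twoIndex_apply_eq_of_mem` — `g a b (x a) = x b` (`b ≤ a`) for `x` compatible under the one-step
  tower; `restrict_mem_compatibleFamilies` — `j ↦ x (m*j)` is compatible for the sub-tower;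
  `extend_mem_compatibleFamilies` — for `x''` compatible for the sub-tower, `i ↦ g (m*i) i (x'' i)` is compatible
  for the fine tower (uses `i ≤ m*i`), and `g (m*(m*j)) (m*j) (x'' (m*j)) = x'' j`.
* §2 **`Tower.levelCondition_subtower_eq`** — `levelCondition red'' p (fun j ↦ C' (m*j)) j =
  levelCondition red' p C' (m*j)` (an equality of subgroups of the common group `H' (m*j)`).

With x10b-p1-w6's levelwise transport `Tower.map_levelCondition_eq` (p-adic level `k` ≅ sub-tower level `k` of
the `π`-adic tower, `T/p^k = T/π^{mk}`) this identifies `F_𝔮 k v` with the `π`-adic level condition at level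
`mk`.  Cell `pub/bsd-print-x9`, shared μ-item of rows 9/10, skeleton v9 STUB 1b (H.3); seat `bsd-line-x10b-p1-w7`.
No summit statement is proved; BSD is not proved by any of this.

References: B. Howard, Compositio Math. 140 (2004), §1.6, Def. 1.1.3 (arXiv:1202.6340 p. 5, p. 12 L29–55);
J.-P. Serre, *Galois Cohomology* (1997), I §2.2 (cohomology with coefficients in a limit of finite modules).
-/

noncomputable section

universe u

namespace Literature.NumberTheory.EllipticCurves

namespace Tower

variable {H' : ℕ → Type u} [∀ i, AddCommGroup (H' i)] (g : ∀ a b, H' a →+ H' b)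

/-! ## §1 Two-index reductions on compatible families; restriction and extension -/

/-- **A two-index reduction evaluates compatible families**: `g a b (x a) = x b` for `b ≤ a` when `x` is
compatible under the one-step reductions `g (i+1) i` and the reductions compose.
[cite: SerreGaloisCohomology1997, Ch. I §2.2 (inverse limits)] [cite: Howard2004HeegnerKolyvagin, §1.6 (arXiv p. 12, L29–55)] -/
theorem twoIndex_apply_eq_of_mem (hid : ∀ a (w : H' a), g a a w = w)
    (hcomp : ∀ a b c, c ≤ b → b ≤ a → ∀ w : H' a, g b c (g a b w) = g a c w)
    {x : Π i, H' i} (hx : x ∈ compatibleFamilies (fun i ↦ g (i + 1) i)) {a b : ℕ} (hab : b ≤ a) :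
    g a b (x a) = x b := by
  obtain ⟨e, rfl⟩ := Nat.exists_eq_add_of_le hab
  induction e with
  | zero => exact hid b (x b)
  | succ e ih =>
    have hxc := (mem_compatibleFamilies_iff _ x).mp hx (b + e)
    change g (b + e + 1) b (x (b + e + 1)) = x b
    rw [← hcomp _ _ _ (Nat.le_add_right b e) (Nat.le_succ _), hxc]
    exact ih (Nat.le_add_right b e)

/-- **Restriction to the sub-tower of `m`-th levels**: `j ↦ x (m*j)` is compatible for the reductions
`g (m*j+m) (m*j)`. [cite: SerreGaloisCohomology1997, Ch. I §2.2 (cofinal subsystems)] -/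
theorem restrict_mem_compatibleFamilies (hid : ∀ a (w : H' a), g a a w = w)
    (hcomp : ∀ a b c, c ≤ b → b ≤ a → ∀ w : H' a, g b c (g a b w) = g a c w) (m : ℕ)
    {x : Π i, H' i} (hx : x ∈ compatibleFamilies (fun i ↦ g (i + 1) i)) :
    (fun j ↦ x (m * j)) ∈ compatibleFamilies (H := fun j ↦ H' (m * j)) (fun j ↦ g (m * j + m) (m * j)) := by
  rw [mem_compatibleFamilies_iff]
  intro j
  exact twoIndex_apply_eq_of_mem g hid hcomp hx (Nat.le_add_right _ _)

/-- **Two-index evaluation on the sub-tower**: `g (m*a) (m*b) (x'' a) = x'' b` for `b ≤ a` and `x''` compatible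
for the sub-tower. [cite: SerreGaloisCohomology1997, Ch. I §2.2 (cofinal subsystems)] -/
theorem twoIndex_mul_apply_eq_of_mem (hid : ∀ a (w : H' a), g a a w = w)
    (hcomp : ∀ a b c, c ≤ b → b ≤ a → ∀ w : H' a, g b c (g a b w) = g a c w) (m : ℕ)
    {x : Π j, H' (m * j)}
    (hx : x ∈ compatibleFamilies (H := fun j ↦ H' (m * j)) (fun j ↦ g (m * j + m) (m * j)))
    {a b : ℕ} (hab : b ≤ a) : g (m * a) (m * b) (x a) = x b := by
  obtain ⟨e, rfl⟩ := Nat.exists_eq_add_of_le hab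
  induction e with
  | zero => exact hid _ (x b)
  | succ e ih =>
    have hxc := (mem_compatibleFamilies_iff (H := fun j ↦ H' (m * j)) _ x).mp hx (b + e)
    change g (m * (b + e) + m) (m * b) (x (b + e + 1)) = x b
    rw [← hcomp _ _ _ (Nat.mul_le_mul_left m (Nat.le_add_right b e)) (Nat.le_add_right _ _), hxc]
    exact ih (Nat.le_add_right b e)

/-- **Extension from the sub-tower**: for `m ≥ 1` and `x''` compatible for the sub-tower, the family
`i ↦ g (m*i) i (x'' i)` (reduce the `(m*i)`-th level, i.e. the `i`-th sub-tower component, down to level `i ≤ m*i`)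
is compatible for the fine tower. [cite: SerreGaloisCohomology1997, Ch. I §2.2 (cofinal subsystems)]
[cite: Howard2004HeegnerKolyvagin, §1.6 (arXiv p. 12, L29–55)] -/
theorem extend_mem_compatibleFamilies (hid : ∀ a (w : H' a), g a a w = w)
    (hcomp : ∀ a b c, c ≤ b → b ≤ a → ∀ w : H' a, g b c (g a b w) = g a c w) {m : ℕ} (hm : 1 ≤ m)
    {x : Π j, H' (m * j)}
    (hx : x ∈ compatibleFamilies (H := fun j ↦ H' (m * j)) (fun j ↦ g (m * j + m) (m * j))) :
    (fun i ↦ g (m * i) i (x i)) ∈ compatibleFamilies (fun i ↦ g (i + 1) i) := by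
  rw [mem_compatibleFamilies_iff]
  intro i
  have hi : i ≤ m * i := Nat.le_mul_of_pos_left i hm
  change g (i + 1) i (g (m * (i + 1)) (i + 1) (x (i + 1))) = g (m * i) i (x i)
  rw [hcomp _ _ _ (Nat.le_succ i) (Nat.le_mul_of_pos_left (i + 1) hm),
    ← twoIndex_mul_apply_eq_of_mem g hid hcomp m hx (Nat.le_succ i),
    hcomp _ _ _ hi (Nat.mul_le_mul_left m (Nat.le_succ i))]

/-- The extension restricts back to `x''`: `g (m*(m*j)) (m*j) (x'' (m*j)) = x'' j`.
[cite: SerreGaloisCohomology1997, Ch. I §2.2 (cofinal subsystems)] -/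
theorem extend_apply_mul (hid : ∀ a (w : H' a), g a a w = w)
    (hcomp : ∀ a b c, c ≤ b → b ≤ a → ∀ w : H' a, g b c (g a b w) = g a c w) {m : ℕ} (hm : 1 ≤ m)
    {x : Π j, H' (m * j)}
    (hx : x ∈ compatibleFamilies (H := fun j ↦ H' (m * j)) (fun j ↦ g (m * j + m) (m * j))) (j : ℕ) :
    g (m * (m * j)) (m * j) (x (m * j)) = x j :=
  twoIndex_mul_apply_eq_of_mem g hid hcomp m hx (Nat.le_mul_of_pos_left j hm)

/-! ## §2 Level conditions of the sub-tower are those of the tower -/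

/-- **Saturated level conditions are insensitive to cofinal refinement**: for `m ≥ 1` and cores `C' i` mapped
into each other by the reductions, the level-`j` condition of the sub-tower of `m`-th levels (cores `C' (m*j)`)
EQUALS the level-`(m*j)` condition of the fine tower, as subgroups of `H' (m*j)`.  `⊇`: restrict a saturated
family to the `m`-th levels.  `⊆`: extend a saturated family of the sub-tower by the reductions
(`extend_mem_compatibleFamilies`); it is saturated with the same exponent because the cores are compatible, and
its `(m*j)`-th component is the given one (`extend_apply_mul`).
[cite: Howard2004HeegnerKolyvagin, §1.6 (arXiv p. 12, L29–55: H¹_F(K,T) = lim over the 𝔪-adic quotients)]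
[cite: SerreGaloisCohomology1997, Ch. I §2.2 (cofinal subsystems)] -/
theorem levelCondition_subtower_eq (hid : ∀ a (w : H' a), g a a w = w)
    (hcomp : ∀ a b c, c ≤ b → b ≤ a → ∀ w : H' a, g b c (g a b w) = g a c w) {m : ℕ} (hm : 1 ≤ m)
    (p : ℕ) (C' : ∀ i, AddSubgroup (H' i)) (hC : ∀ a b, b ≤ a → ∀ w ∈ C' a, g a b w ∈ C' b) (j : ℕ) :
    levelCondition (H := fun j ↦ H' (m * j)) (fun j ↦ g (m * j + m) (m * j)) p (fun j ↦ C' (m * j)) j =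
      levelCondition (fun i ↦ g (i + 1) i) p C' (m * j) := by
  ext y
  rw [mem_levelCondition_iff, mem_levelCondition_iff]
  constructor
  · rintro ⟨x, hx, rfl⟩
    obtain ⟨hxc, a, ha⟩ := (mem_saturatedFamilies_iff (H := fun j ↦ H' (m * j)) _ p _ x).mp hx
    have hxc' : x ∈ compatibleFamilies (H := fun j ↦ H' (m * j)) (fun j ↦ g (m * j + m) (m * j)) :=
      (mem_compatibleFamilies_iff (H := fun j ↦ H' (m * j)) _ x).mpr hxc
    refine ⟨fun i ↦ g (m * i) i (x i), (mem_saturatedFamilies_iff _ p C' _).mpr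
      ⟨(mem_compatibleFamilies_iff _ _).mp (extend_mem_compatibleFamilies g hid hcomp hm hxc'), a,
        fun i ↦ ?_⟩, extend_apply_mul g hid hcomp hm hxc' j⟩
    rw [← map_nsmul]
    exact hC _ _ (Nat.le_mul_of_pos_left i hm) _ (ha i)
  · rintro ⟨x, hx, rfl⟩
    obtain ⟨hxc, a, ha⟩ := (mem_saturatedFamilies_iff _ p C' x).mp hx
    have hxc' : x ∈ compatibleFamilies (fun i ↦ g (i + 1) i) := (mem_compatibleFamilies_iff _ x).mpr hxc
    exact ⟨fun j ↦ x (m * j), (mem_saturatedFamilies_iff (H := fun j ↦ H' (m * j)) _ p _ _).mpr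
      ⟨(mem_compatibleFamilies_iff (H := fun j ↦ H' (m * j)) _ _).mp
        (restrict_mem_compatibleFamilies g hid hcomp m hxc'), a, fun j ↦ ha (m * j)⟩, rfl⟩

end Tower

end Literature.NumberTheory.EllipticCurves

end
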